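import Summits.ResolutionOfSingularities.ResolutionOfSingularities.Theses.EquisingularLift
import Mathlib.Algebra.TrivSqZeroExt.Basic
import Mathlib.RingTheory.PrincipalIdealDomain
import Mathlib.Algebra.MvPolynomial.Basic
import Mathlib.RingTheory.Ideal.Quotient.Operations

/-!
# `EquisingularLiftNat` — negative lemma: a 0-dimensional centre trace with two heavy weights is not the
# special fibre of a horizontal `O`-point (the trace `k[x,y]/(xᵃ, yᵇ)`, `a, b ≥ 2`, is no quotient of a
# principal ideal ring)

Support (negative) lemma for crux `stmt-ResolutionOfSingularities-20038`
(`Summit.ResolutionOfSingularities.ResolutionOfSingularities.Theses.EquisingularLift.EquisingularLiftNat`), filed by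
triager 2 (res-L1-w45b-tri-2, gen 3; crux chain w45b). [OURS · L1 W4.5b] No definition is declared and no theorem
asserts a Theses decl positively.

CONTENT. In an E1 tower of `EquisingularLiftNat` a 0-dimensional step downstairs is the blow-up of the special fibre
`Z = C ×_O k` of a REGULAR one-dimensional centre `C` finite flat over the discrete valuation ring `O`; locally `C = Spec O'`
with `O'` a discrete valuation ring, so `Z = Spec O'/(ϖ)` is a quotient of a principal ideal ring and hence CURVILINEAR
(`k[x]/(xᵉ)`). `twoHeavyWeights_not_horizontal` is the typed hinge `TwoHeavyWeightsNotHorizontal` of idea card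
`curvilinear-weights` (res-L1-w45b-idea-2, round 3, Sketch-L1-idea-2.lean v3 — there with `sorry`), verbatim: for a field `k`
and `a, b ≥ 2` the weighted jet `k[x,y]/(xᵃ, yᵇ)` admits no surjection from any principal ideal ring — so the toric /
weighted centres with two heavy weights (the «kangaroo cures» of CRUX-PLAN v2) are never single horizontal steps.
Proof: a quotient of a principal ideal ring is one (`IsPrincipalIdealRing.of_surjective`); `k[x,y]/(xᵃ,yᵇ)` surjects onto
the square-zero extension `k ⊕ k²` (`TrivSqZeroExt k (k × k)`, `x ↦ (0,(1,0))`, `y ↦ (0,(0,1))`), whose augmentation ideal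
`0 ⊕ k²` is not principal (`not_isPrincipalIdealRing_trivSqZeroExt`: a generator `(0,v)` spans only the line `k·v`).
Kernel-only (propext, Classical.choice, Quot.sound). [folklore]
-/

noncomputable section

set_option linter.dupNamespace false

namespace Summit.ResolutionOfSingularities.ResolutionOfSingularities.Theorems.EquisingularLift.Negative

open TrivSqZeroExt

/-- The square-zero extension `k ⊕ k²` of a field by a 2-dimensional vector space is not a principal ideal ring:
its augmentation ideal `0 ⊕ k²` (the kernel of `fst`) is not principal. [folklore] -/
theorem not_isPrincipalIdealRing_trivSqZeroExt (k : Type*) [Field k] :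
    ¬ IsPrincipalIdealRing (TrivSqZeroExt k (k × k)) := by
  intro hP
  let f : TrivSqZeroExt k (k × k) →+* k := (TrivSqZeroExt.fstHom k k (k × k)).toRingHom
  have hf : ∀ x : TrivSqZeroExt k (k × k), f x = x.fst := fun x => rfl
  obtain ⟨z, hz⟩ := (IsPrincipalIdealRing.principal (RingHom.ker f)).principal
  have hz0 : z.fst = 0 := by
    have hzm : z ∈ RingHom.ker f := by rw [hz]; exact Submodule.mem_span_singleton_self z
    rw [RingHom.mem_ker, hf] at hzm
    exact hzm
  have h1 : (inr ((1 : k), (0 : k)) : TrivSqZeroExt k (k × k)) ∈ RingHom.ker f := by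
    rw [RingHom.mem_ker, hf, fst_inr]
  have h2 : (inr ((0 : k), (1 : k)) : TrivSqZeroExt k (k × k)) ∈ RingHom.ker f := by
    rw [RingHom.mem_ker, hf, fst_inr]
  rw [hz] at h1 h2
  obtain ⟨r, hr⟩ := Ideal.mem_span_singleton'.mp h1
  obtain ⟨s, hs⟩ := Ideal.mem_span_singleton'.mp h2
  have er := congrArg TrivSqZeroExt.snd hr
  have es := congrArg TrivSqZeroExt.snd hs
  rw [snd_mul, hz0, MulOpposite.op_zero, zero_smul, add_zero, snd_inr] at er es
  have e1 := congrArg Prod.fst er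
  have e2 := congrArg Prod.snd er
  have e4 := congrArg Prod.snd es
  simp only [Prod.smul_fst, Prod.smul_snd, smul_eq_mul] at e1 e2 e4
  rcases mul_eq_zero.mp e2 with h | h
  · rw [h, zero_mul] at e1
    exact zero_ne_one e1
  · rw [h, mul_zero] at e4
    exact zero_ne_one e4

/-- **Two heavy weights are not horizontal** (typed hinge `TwoHeavyWeightsNotHorizontal` of card `curvilinear-weights`,
verbatim): for a field `k` and `2 ≤ a`, `2 ≤ b`, no principal ideal ring surjects onto `k[x,y]/(xᵃ, yᵇ)`. In particular
this jet is not `O'/(ϖ)` for a discrete valuation ring `O'`, i.e. not the special fibre of a regular horizontal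
one-dimensional centre: 0-dimensional E1 centre traces are curvilinear. [folklore] -/
theorem twoHeavyWeights_not_horizontal (k : Type) [Field k] (a b : ℕ) (ha : 2 ≤ a) (hb : 2 ≤ b)
    (C : Type) [CommRing C] [IsPrincipalIdealRing C] :
    ¬ ∃ φ : C →+* (MvPolynomial (Fin 2) k ⧸
        Ideal.span {(MvPolynomial.X 0 ^ a : MvPolynomial (Fin 2) k), MvPolynomial.X 1 ^ b}),
      Function.Surjective φ := by
  rintro ⟨φ, hφ⟩
  have hnil : ∀ (m : k × k) (n : ℕ), 2 ≤ n → (inr m : TrivSqZeroExt k (k × k)) ^ n = 0 := by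
    intro m n hn
    obtain ⟨c, rfl⟩ := Nat.exists_eq_add_of_le hn
    rw [pow_add, pow_two, inr_mul_inr, zero_mul]
  let ev : MvPolynomial (Fin 2) k →+* TrivSqZeroExt k (k × k) :=
    (MvPolynomial.aeval (![inr (1, 0), inr (0, 1)] : Fin 2 → TrivSqZeroExt k (k × k))).toRingHom
  have hev : ∀ p, ev p = MvPolynomial.aeval (![inr (1, 0), inr (0, 1)] : Fin 2 → TrivSqZeroExt k (k × k)) p :=
    fun p => rfl
  have hI : ∀ p ∈ Ideal.span {(MvPolynomial.X 0 ^ a : MvPolynomial (Fin 2) k), MvPolynomial.X 1 ^ b}, ev p = 0 := by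
    intro p hp
    have hle : Ideal.span {(MvPolynomial.X 0 ^ a : MvPolynomial (Fin 2) k), MvPolynomial.X 1 ^ b} ≤
        RingHom.ker ev := by
      rw [Ideal.span_le]
      rintro q hq
      simp only [Set.mem_insert_iff, Set.mem_singleton_iff] at hq
      rcases hq with rfl | rfl
      · rw [SetLike.mem_coe, RingHom.mem_ker, hev, map_pow, MvPolynomial.aeval_X]
        exact hnil _ _ ha
      · rw [SetLike.mem_coe, RingHom.mem_ker, hev, map_pow, MvPolynomial.aeval_X]
        exact hnil _ _ hb
    exact hle hp
  let ψ := Ideal.Quotient.lift _ ev hI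
  have hψ : Function.Surjective ψ := by
    intro t
    refine ⟨Ideal.Quotient.mk _ (MvPolynomial.C t.fst + MvPolynomial.C t.snd.1 * MvPolynomial.X 0 +
      MvPolynomial.C t.snd.2 * MvPolynomial.X 1), ?_⟩
    rw [Ideal.Quotient.lift_mk, hev]
    simp only [map_add, map_mul, MvPolynomial.aeval_C, MvPolynomial.aeval_X, Matrix.cons_val_zero,
      Matrix.cons_val_one, algebraMap_eq_inl, inl_mul_inr]
    refine TrivSqZeroExt.ext ?_ ?_
    · simp
    · simp
  exact not_isPrincipalIdealRing_trivSqZeroExt k (IsPrincipalIdealRing.of_surjective (ψ.comp φ) (hψ.comp hφ))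

end Summit.ResolutionOfSingularities.ResolutionOfSingularities.Theorems.EquisingularLift.Negative

end
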